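import Literature.MeasureTheory.Hausdorff.CylinderHausdorffMeasure
import HarnessLib

/-!
# The Hausdorff measure of the round unit cylinder is the product measure: `μHE[n]⌊Cyl = ν`

Setting as in `CylinderHausdorffMeasure.lean`: `dim E = n + 1`, `V ≤ E` with `dim V = k + 1`,
`k ≥ 1`, `Cyl = {‖P_V z‖ = 1}`, `ν = f_* (μHE[k]⌊S_V ⊗ vol_{Vᗮ})`, `f (a, b) = a + b`. There it is
shown that `μHE[n]⌊Cyl = c • ν` for some constant `c`. Here **`c = 1`**
(`euclideanHausdorff_restrict_cylinder_eq_productMeasure`), by squeezing the patches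
`P_t = {P_V z ∈ cap v t, ‖P_{Vᗮ} z‖ < 1}` (`t → 1⁻`, `ρ = √(1 - t²) → 0`, `L = 1 + ρ/t → 1`):

* `le_euclideanHausdorffMeasure_patch` — `vol_{K₁}(B_ρ) vol_{Vᗮ}(B_1) ≤ μHE[n] (P_t)`: the
  orthogonal projection onto the `n`-plane `W = K₁ ⊔ Vᗮ` is `1`-Lipschitz and maps `P_t` onto a
  set containing the box `Q` (the graph map of `CylinderHausdorffPatch.lean` is a right inverse);
* with `μHE[n] (P_t) ≤ L^n vol(B_ρ) vol(B_1)` (`euclideanHausdorffMeasure_patch_le`) and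
  `vol(B_ρ) vol(B_1) ≤ ν (P_t) = μHE[k](cap) vol(B_1) ≤ L^k vol(B_ρ) vol(B_1)` (the cap bounds of
  `SphereAreaGeneral.lean`, `dim K₁ = k`), `L^{-k} ≤ c ≤ L^n` (`inv_pow_le_cylinderConst_le`),
  whence `c = 1`.

Support for `Literature.Geometry.Riemannian.Stone1994_cylinderEntropy`.

## References

* H. Federer, *Geometric measure theory* (1969), 3.2.23 (Hausdorff measure of product sets; here
  for the round cylinder only, without the general theory).
* P. Mattila, *Geometry of sets and measures in Euclidean spaces* (1995), Thm. 3.4, §4.3.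
-/

noncomputable section

open Set Metric Module Submodule Filter Function
open _root_.MeasureTheory _root_.MeasureTheory.Measure
open scoped ENNReal NNReal Topology RealInnerProductSpace Pointwise

namespace Literature.MeasureTheory.Hausdorff

variable {E : Type*} [NormedAddCommGroup E] [InnerProductSpace ℝ E] [FiniteDimensional ℝ E]
  [MeasurableSpace E] [BorelSpace E]

/-! ### Lower bound for the Hausdorff measure of a patch -/

section Lower

variable {V : Submodule ℝ E} {v : V} {K₁ : Submodule ℝ E}

omit [MeasurableSpace E] [BorelSpace E] in
/-- **The graph lands in the patch**: for `w` in the box `Q` (`‖P_{K₁} w‖ < √(1 - c²)`,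
`‖P_{Vᗮ} w‖ < ρ₂`), `G w = w + √(1 - ‖P_{K₁} w‖²) v` lies in the patch
`{P_V z ∈ cap v c, ‖P_{Vᗮ} z‖ < ρ₂}` and projects back to `w`. [folklore] -/
theorem patchLift_mem_patch_and_proj (hv : ‖v‖ = 1)
    (hK₁ : K₁ = ((ℝ ∙ v)ᗮ : Submodule ℝ V).map V.subtype) {c : ℝ} (hc0 : 0 < c) (ρ₂ : ℝ)
    {w : ↥(K₁ ⊔ Vᗮ)} (hw1 : ‖K₁.orthogonalProjectionOnto (w : E)‖ < Real.sqrt (1 - c ^ 2))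
    (hw2 : ‖Vᗮ.orthogonalProjectionOnto (w : E)‖ < ρ₂) :
    ((w : E) + Real.sqrt (1 - ‖K₁.orthogonalProjectionOnto (w : E)‖ ^ 2) • (v : E)) ∈
        {z : E | V.orthogonalProjectionOnto z ∈ cap v c ∧ ‖Vᗮ.orthogonalProjectionOnto z‖ < ρ₂} ∧
      (K₁ ⊔ Vᗮ).orthogonalProjectionOnto
          ((w : E) + Real.sqrt (1 - ‖K₁.orthogonalProjectionOnto (w : E)‖ ^ 2) • (v : E)) = w := by
  have hle : Vᗮ ≤ K₁ᗮ := (patchPlane_isOrtho hK₁).symm.le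
  -- decompose `w = a₁ + b`, `a₁ ∈ K₁`, `b ∈ Vᗮ`
  obtain ⟨a₁, ha₁, b, hb, hw⟩ := Submodule.mem_sup.1 w.2
  obtain ⟨a', ha'v, ha'⟩ := (mem_patchPlane_iff hK₁).1 ha₁
  have hproj₁ : K₁.orthogonalProjectionOnto (w : E) = ⟨a₁, ha₁⟩ := by
    rw [← hw, map_add, orthogonalProjectionOnto_apply_of_mem_orthogonal (hle hb), add_zero]
    exact orthogonalProjectionOnto_mem_subspace_eq_self (⟨a₁, ha₁⟩ : K₁)
  have hproj₂ : Vᗮ.orthogonalProjectionOnto (w : E) = ⟨b, hb⟩ := by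
    rw [← hw, map_add, orthogonalProjectionOnto_apply_of_mem_orthogonal
      ((patchPlane_isOrtho hK₁).le ha₁), zero_add]
    exact orthogonalProjectionOnto_mem_subspace_eq_self (⟨b, hb⟩ : Vᗮ)
  have hn : ‖K₁.orthogonalProjectionOnto (w : E)‖ = ‖a'‖ := by
    rw [hproj₁]
    show ‖a₁‖ = ‖a'‖
    rw [← ha']
    rfl
  set a'' : ((ℝ ∙ v)ᗮ : Submodule ℝ V) := ⟨a', (mem_orthogonal_singleton_iff_inner_right).2 ha'v⟩
    with ha''
  have hn' : ‖a''‖ = ‖a'‖ := rfl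
  have ha''lt : ‖a''‖ < Real.sqrt (1 - c ^ 2) := by rw [hn', ← hn]; exact hw1
  -- `P_V (G w) = capLift v a''`
  have hlift : ((capLift v a'' : V) : E) = a₁ + Real.sqrt (1 - ‖a'‖ ^ 2) • (v : E) := by
    rw [capLift, Submodule.coe_add, Submodule.coe_smul, hn', ← ha']
  have hGw : (w : E) + Real.sqrt (1 - ‖K₁.orthogonalProjectionOnto (w : E)‖ ^ 2) • (v : E) =
      ((capLift v a'' : V) : E) + b := by
    rw [hlift, hn, ← hw]; abel
  refine ⟨⟨?_, ?_⟩, ?_⟩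
  · rw [hGw, map_add, orthogonalProjectionOnto_mem_subspace_eq_self,
      orthogonalProjectionOnto_apply_of_mem_orthogonal hb, add_zero]
    exact capLift_mem_cap hv hc0 ha''lt
  · rw [hGw, map_add, orthogonalProjectionOnto_orthogonal_apply_eq_zero (capLift v a'').2, zero_add,
      orthogonalProjectionOnto_mem_subspace_eq_self (⟨b, hb⟩ : Vᗮ)]
    rw [hproj₂] at hw2; exact hw2
  · rw [map_add, map_smul, orthogonalProjectionOnto_mem_subspace_eq_self]
    have hvW : (v : E) ∈ (K₁ ⊔ Vᗮ)ᗮ := by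
      rw [Submodule.mem_orthogonal']
      intro u hu
      exact inner_eq_zero_of_mem_patchPlane_sup hK₁ hu
    rw [orthogonalProjectionOnto_apply_of_mem_orthogonal hvW, smul_zero, add_zero]

/-- **Lower bound for the Hausdorff measure of a patch**:
`vol_{K₁}(B_ρ) · vol_{Vᗮ}(B_{ρ₂}) ≤ μHE[n] {P_V z ∈ cap v c, ‖P_{Vᗮ} z‖ < ρ₂}`, `ρ = √(1 - c²)`
(`dim E = n + 1`, `dim V = k + 1`; the orthogonal projection onto the `n`-plane `K₁ ⊔ Vᗮ` is
`1`-Lipschitz and its image of the patch contains the box). [folklore] -/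
theorem le_euclideanHausdorffMeasure_patch {n k : ℕ} (hE : finrank ℝ E = n + 1)
    (hV : finrank ℝ V = k + 1) (hv : ‖v‖ = 1)
    (hK₁ : K₁ = ((ℝ ∙ v)ᗮ : Submodule ℝ V).map V.subtype) {c : ℝ} (hc0 : 0 < c) (ρ₂ : ℝ) :
    (volume : Measure K₁) (ball 0 (Real.sqrt (1 - c ^ 2))) * (volume : Measure Vᗮ) (ball 0 ρ₂) ≤
      (μHE[n] : Measure E)
        {z : E | V.orthogonalProjectionOnto z ∈ cap v c ∧ ‖Vᗮ.orthogonalProjectionOnto z‖ < ρ₂} := by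
  set ρ := Real.sqrt (1 - c ^ 2) with hρ_def
  have hW : finrank ℝ ↥(K₁ ⊔ Vᗮ) = n := finrank_patchPlane_sup hE hV hv hK₁
  set Q : Set ↥(K₁ ⊔ Vᗮ) := {w | ‖K₁.orthogonalProjectionOnto (w : E)‖ < ρ ∧
    ‖Vᗮ.orthogonalProjectionOnto (w : E)‖ < ρ₂} with hQ_def
  set P : Set E := {z : E | V.orthogonalProjectionOnto z ∈ cap v c ∧
    ‖Vᗮ.orthogonalProjectionOnto z‖ < ρ₂} with hP_def
  have hQ : (μHE[n] : Measure ↥(K₁ ⊔ Vᗮ)) Q =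
      (volume : Measure K₁) (ball 0 ρ) * (volume : Measure Vᗮ) (ball 0 ρ₂) := by
    have hset : Q = {w : ↥(K₁ ⊔ Vᗮ) | K₁.orthogonalProjectionOnto (w : E) ∈ ball (0 : K₁) ρ ∧
        Vᗮ.orthogonalProjectionOnto (w : E) ∈ ball (0 : Vᗮ) ρ₂} := by
      ext w; simp [hQ_def]
    subst hW
    rw [hset, InnerProductSpace.euclideanHausdorffMeasure_eq_volume]
    exact volume_sup_setOf_orthogonalProjection_mem_prod K₁ Vᗮ (patchPlane_isOrtho hK₁)
      measurableSet_ball measurableSet_ball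
  have hsub : Q ⊆ (K₁ ⊔ Vᗮ).orthogonalProjectionOnto '' P := by
    intro w hw
    obtain ⟨hmem, hproj⟩ := patchLift_mem_patch_and_proj hv hK₁ hc0 ρ₂ hw.1 hw.2
    exact ⟨_, hmem, hproj⟩
  have h2 := ((K₁ ⊔ Vᗮ).lipschitzWith_orthogonalProjectionOnto.lipschitzOnWith
    (s := P)).euclideanHausdorffMeasure_image_le n
  rw [ENNReal.coe_one, one_pow, one_mul] at h2
  rw [← hQ]
  exact (measure_mono hsub).trans h2

end Lower

/-! ### The squeeze: `c = 1` -/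

section Squeeze

variable (V : Submodule ℝ E)

/-- **The squeeze for the cylinder constant.** If `μHE[n]⌊Cyl = c • ν` then for every
`t ∈ (0,1)`, with `L = 1 + √(1 - t²)/t`: `1 ≤ L^k c` and `c ≤ L^n` (patches of height `t`).
[folklore] -/
theorem inv_pow_le_cylinderConst_le {n k : ℕ} (hE : finrank ℝ E = n + 1)
    (hV : finrank ℝ V = k + 1) (hk : 0 < k) {c : ℝ≥0∞}
    (hc : (μHE[n] : Measure E).restrict {z : E | ‖V.orthogonalProjectionOnto z‖ = 1} =
      c • Measure.map (fun p : V × Vᗮ ↦ (p.1 : E) + (p.2 : E))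
        (((μHE[k] : Measure V).restrict (sphere 0 1)).prod (volume : Measure Vᗮ)))
    {t : ℝ} (ht0 : 0 < t) (ht1 : t < 1) :
    1 ≤ ENNReal.ofReal ((1 + Real.sqrt (1 - t ^ 2) / t) ^ k) * c ∧
      c ≤ ENNReal.ofReal ((1 + Real.sqrt (1 - t ^ 2) / t) ^ n) := by
  -- a pole and the plane `K₁`
  haveI : Fact (finrank ℝ V = k + 1) := ⟨hV⟩
  have hnt : Nontrivial V := Module.nontrivial_of_finrank_pos (R := ℝ) (by omega)
  obtain ⟨v, hv'⟩ := (NormedSpace.sphere_nonempty (E := V) (x := 0) (r := 1)).2 zero_le_one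
  have hv : ‖v‖ = 1 := by simpa using hv'
  have hv0 : v ≠ 0 := fun h ↦ by simp [h] at hv
  set K₁ : Submodule ℝ E := ((ℝ ∙ v)ᗮ : Submodule ℝ V).map V.subtype with hK₁
  have hKv : finrank ℝ ((ℝ ∙ v)ᗮ : Submodule ℝ V) = k := finrank_orthogonal_span_singleton hv0
  have hK₁k : finrank ℝ K₁ = k := finrank_patchPlane hV hv hK₁
  -- the numbers
  set ρ : ℝ := Real.sqrt (1 - t ^ 2) with hρ_def
  set L : ℝ := 1 + ρ / t with hL_def
  set C : ℝ := Real.sqrt Real.pi ^ k / Real.Gamma ((k : ℝ) / 2 + 1) with hC_def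
  set Bk : ℝ≥0∞ := (volume : Measure K₁) (ball 0 ρ) with hBk_def
  set Bm : ℝ≥0∞ := (volume : Measure Vᗮ) (ball 0 1) with hBm_def
  have hBk : Bk = ENNReal.ofReal ρ ^ k * ENNReal.ofReal C := by
    haveI : Nontrivial K₁ := Module.nontrivial_of_finrank_pos (R := ℝ) (by omega)
    rw [hBk_def, InnerProductSpace.volume_ball (0 : K₁) ρ, hK₁k]
  have hBk0 : Bk ≠ 0 := (measure_ball_pos _ _ (Real.sqrt_pos.2 (by nlinarith))).ne'
  have hBktop : Bk ≠ ⊤ := measure_ball_lt_top.ne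
  have hBm0 : Bm ≠ 0 := (measure_ball_pos _ _ one_pos).ne'
  have hBmtop : Bm ≠ ⊤ := measure_ball_lt_top.ne
  -- the patch and its measures
  set P : Set E := {z : E | V.orthogonalProjectionOnto z ∈ cap v t ∧
    ‖Vᗮ.orthogonalProjectionOnto z‖ < 1} with hP_def
  have hPsub : P ⊆ {z : E | ‖V.orthogonalProjectionOnto z‖ = 1} := fun z hz ↦ hz.1.1
  have hPmeas : MeasurableSet P := by
    have hcap : MeasurableSet (cap v t) := by
      have : cap v t = sphere (0 : V) 1 ∩ {x : V | t < ⟪v, x⟫} := by ext x; simp [cap]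
      rw [this]
      exact isClosed_sphere.measurableSet.inter
        (isOpen_lt continuous_const (continuous_const.inner continuous_id)).measurableSet
    have h1 : MeasurableSet (V.orthogonalProjectionOnto ⁻¹' cap v t) :=
      V.orthogonalProjectionOnto.continuous.measurable hcap
    have h2 : MeasurableSet {z : E | ‖Vᗮ.orthogonalProjectionOnto z‖ < 1} :=
      measurableSet_lt (Vᗮ.orthogonalProjectionOnto.continuous.norm).measurable measurable_const
    exact h1.inter h2
  have hμP : (μHE[n] : Measure E) P = c * ((μHE[k] : Measure V) (cap v t) * Bm) := by
    have h := congrArg (fun μ : Measure E ↦ μ P) hc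
    simp only [Measure.restrict_apply hPmeas, inter_eq_left.2 hPsub, Measure.smul_apply,
      smul_eq_mul] at h
    rw [h, map_add_prod_apply_patch]
  -- the four bounds
  have hup : (μHE[n] : Measure E) P ≤ ENNReal.ofReal (L ^ n) * (Bk * Bm) :=
    euclideanHausdorffMeasure_patch_le hE hV hv hK₁ ht0 ht1 1
  have hlow : Bk * Bm ≤ (μHE[n] : Measure E) P := le_euclideanHausdorffMeasure_patch hE hV hv hK₁ ht0 1
  have hcaplow : Bk ≤ (μHE[k] : Measure V) (cap v t) := by
    rw [hBk]; exact le_euclideanHausdorffMeasure_cap_general hv hKv hk ht0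
  have hcapup : (μHE[k] : Measure V) (cap v t) ≤ ENNReal.ofReal (L ^ k) * Bk := by
    rw [hBk]; exact euclideanHausdorffMeasure_cap_le_general hv hKv hk ht0 ht1
  constructor
  · -- `Bk Bm ≤ μ P = c μHE[k](cap) Bm ≤ c L^k Bk Bm`
    have h1 : Bk * Bm ≤ ENNReal.ofReal (L ^ k) * c * (Bk * Bm) := by
      calc Bk * Bm ≤ (μHE[n] : Measure E) P := hlow
        _ = c * ((μHE[k] : Measure V) (cap v t) * Bm) := hμP
        _ ≤ c * (ENNReal.ofReal (L ^ k) * Bk * Bm) := by gcongr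
        _ = ENNReal.ofReal (L ^ k) * c * (Bk * Bm) := by ring
    calc (1 : ℝ≥0∞) = (Bk * Bm) / (Bk * Bm) :=
          (ENNReal.div_self (mul_ne_zero hBk0 hBm0) (ENNReal.mul_ne_top hBktop hBmtop)).symm
      _ ≤ (ENNReal.ofReal (L ^ k) * c * (Bk * Bm)) / (Bk * Bm) := by gcongr
      _ = ENNReal.ofReal (L ^ k) * c := ENNReal.mul_div_cancel_right (mul_ne_zero hBk0 hBm0)
          (ENNReal.mul_ne_top hBktop hBmtop)
  · -- `c Bk Bm ≤ c μHE[k](cap) Bm = μ P ≤ L^n Bk Bm`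
    have h1 : c * (Bk * Bm) ≤ ENNReal.ofReal (L ^ n) * (Bk * Bm) := by
      calc c * (Bk * Bm) ≤ c * ((μHE[k] : Measure V) (cap v t) * Bm) := by gcongr
        _ = (μHE[n] : Measure E) P := hμP.symm
        _ ≤ ENNReal.ofReal (L ^ n) * (Bk * Bm) := hup
    calc c = c * (Bk * Bm) / (Bk * Bm) := (ENNReal.mul_div_cancel_right (mul_ne_zero hBk0 hBm0)
          (ENNReal.mul_ne_top hBktop hBmtop)).symm
      _ ≤ ENNReal.ofReal (L ^ n) * (Bk * Bm) / (Bk * Bm) := by gcongr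
      _ = ENNReal.ofReal (L ^ n) := ENNReal.mul_div_cancel_right (mul_ne_zero hBk0 hBm0)
          (ENNReal.mul_ne_top hBktop hBmtop)

/-- **The Hausdorff measure of the round unit cylinder is the product measure.** For a real
inner product space `E` of dimension `n + 1` and a subspace `V` of dimension `k + 1` (`k ≥ 1`),
`μHE[n]⌊{‖P_V z‖ = 1} = f_* (μHE[k]⌊S_V ⊗ vol_{Vᗮ})`, `f (a, b) = a + b`: the `n`-dimensional
Hausdorff measure of `S^k × ℝ^{n-k}` is the product of the `k`-dimensional Hausdorff (surface)
measure of `S^k` with Lebesgue measure (Federer 1969, 3.2.23, for this special case).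
[folklore] -/
theorem euclideanHausdorff_restrict_cylinder_eq_productMeasure {n k : ℕ} (hE : finrank ℝ E = n + 1)
    (hV : finrank ℝ V = k + 1) (hk : 0 < k) :
    (μHE[n] : Measure E).restrict {z : E | ‖V.orthogonalProjectionOnto z‖ = 1} =
      Measure.map (fun p : V × Vᗮ ↦ (p.1 : E) + (p.2 : E))
        (((μHE[k] : Measure V).restrict (sphere 0 1)).prod (volume : Measure Vᗮ)) := by
  obtain ⟨c, hctop, hc⟩ := exists_euclideanHausdorff_restrict_cylinder_eq_smul V hE hV hk
  suffices hc1 : c = 1 by rw [hc, hc1, one_smul]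
  -- `L(t)^{-k} ≤ c ≤ L(t)^n` for `t ∈ (0,1)`, and `L(t) → 1` as `t → 1⁻`
  have hev : ∀ᶠ t in 𝓝[<] (1 : ℝ), 1 ≤ (1 + Real.sqrt (1 - t ^ 2) / t) ^ k * c.toReal ∧
      c.toReal ≤ (1 + Real.sqrt (1 - t ^ 2) / t) ^ n := by
    filter_upwards [Ioo_mem_nhdsLT one_pos] with t ht
    have h := inv_pow_le_cylinderConst_le V hE hV hk hc ht.1 ht.2
    have hL0 : 0 ≤ 1 + Real.sqrt (1 - t ^ 2) / t := by
      have := Real.sqrt_nonneg (1 - t ^ 2); have := ht.1; positivity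
    constructor
    · have h1 := ENNReal.toReal_mono (ENNReal.mul_ne_top ENNReal.ofReal_ne_top hctop) h.1
      rwa [ENNReal.toReal_one, ENNReal.toReal_mul, ENNReal.toReal_ofReal (pow_nonneg hL0 _)] at h1
    · have h1 := ENNReal.toReal_mono ENNReal.ofReal_ne_top h.2
      rwa [ENNReal.toReal_ofReal (pow_nonneg hL0 _)] at h1
  have hLlim : Tendsto (fun t : ℝ ↦ 1 + Real.sqrt (1 - t ^ 2) / t) (𝓝[<] (1 : ℝ)) (𝓝 1) := by
    have hcont : ContinuousAt (fun t : ℝ ↦ 1 + Real.sqrt (1 - t ^ 2) / t) 1 := by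
      fun_prop (disch := norm_num)
    have := hcont.tendsto
    simp only [one_pow, sub_self, Real.sqrt_zero, zero_div, add_zero] at this
    exact this.mono_left nhdsWithin_le_nhds
  have hlow : Tendsto (fun t : ℝ ↦ (1 + Real.sqrt (1 - t ^ 2) / t) ^ k * c.toReal) (𝓝[<] (1 : ℝ))
      (𝓝 (c.toReal)) := by
    have := (hLlim.pow k).mul_const c.toReal
    rwa [one_pow, one_mul] at this
  have hup : Tendsto (fun t : ℝ ↦ (1 + Real.sqrt (1 - t ^ 2) / t) ^ n) (𝓝[<] (1 : ℝ)) (𝓝 1) := by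
    have := hLlim.pow n
    rwa [one_pow] at this
  have h1 : 1 ≤ c.toReal := ge_of_tendsto hlow (hev.mono fun t ht ↦ ht.1)
  have h2 : c.toReal ≤ 1 := ge_of_tendsto hup (hev.mono fun t ht ↦ ht.2)
  rw [← ENNReal.ofReal_toReal hctop, le_antisymm h2 h1, ENNReal.ofReal_one]

end Squeeze

end Literature.MeasureTheory.Hausdorff

end
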